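import Literature.NumberTheory.IwasawaTheory.FukudaRankCountingLemmas
import Literature.NumberTheory.NumberFields.ArtinMapDecompositionInertia
import Literature.NumberTheory.GaloisRepresentations.GlobalArtinMapOfCharactersProofs
import Literature.NumberTheory.GaloisRepresentations.ArtinRestriction
import Literature.NumberTheory.GaloisRepresentations.FrobeniusDensityTheorem
import HarnessLib

/-!
# Everywhere-unramified `p`-torsion-valued homomorphisms on an open normal subgroup of `Γ_K` are bounded
# by the `p`-rank of the class group of its fixed field (class field theory, finite level; proved)

`Proofs`-style file (theorems only: no definition, no named fact, no `sorry`) in topic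
`NumberTheory/NumberFields`, namespace `Literature.NumberTheory.NumberFields.UnramifiedHomsClassGroupPRankBound`,
written by the prover seat `bsd-potss-k8t-c4` g21 (cell `bsd-potss`, K8-t′ route, item
stmt-BirchSwinnertonDyer-19982; closes nothing). Second brick of the discharge, in bounded-`p`-rank form, of
Coates–Sujatha 2005 Thm. 3.4 (`CoatesSujatha2005.thm34_…`): the CLASS-FIELD-THEORETIC COUNT.

**Theorem** (`card_le_pow_index_of_unramified`). Let `K` be a number field, `p` an odd prime, `U ≤ Γ_K` an
open normal subgroup with fixed field `F = K̄^U`, `W ≤ U` an open subgroup normal in `Γ_K`, and `M` a finite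
abelian group killed by `p`. Every finite set `T` of additive maps `g : U → M` that kill `W` and kill
`U ∩ I_𝔓` for EVERY maximal ideal `𝔓` of `\bar ℤ_K` has
`#T ≤ #M ^ [Cl(F) : Cl(F)^p]`.

Proof (Washington §13.3 Lemma 13.15 / Prop. 13.23 as already formalised by the tree's
`index_sup_pow_dvd_index_range_pow`, Cox Cor. 5.24): §1 the open normal subgroup
`U' = W · [U,U] · U^p ≤ U` is killed by every `g`; §2 its fixed field `E' = K̄^{U'}` is finite Galois over `K`
and over `F`, with `G = Gal(E'/F)` of exponent `p`, hence of odd order, hence `E'/F` is unramified at the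
infinite places (Mathlib `IsUnramifiedAtInfinitePlaces_of_odd_card_aut`); restriction `π : U ↠ G` and the
descended maps `ḡ : G → M`; §3 the inertia group in `G` of a maximal ideal `Q` of `𝓞 E'` is the restriction
of the absolute inertia group of a prime `𝔓 ∣ Q` of `\bar ℤ_K` (tree
`inertia_comap_ringOfIntegers_eq_map_absRestrictNormalHom`), so every `ḡ` kills it; §4 by the tree's
`index_sup_pow_dvd_index_range_pow` the subgroup `N` generated by commutators, inertia groups and `p`-th
powers has `[G : N] ∣ [Cl(F) : Cl(F)^p]`, and the `ḡ` are distinct functions on `G/N`.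

This is the finite-level content of «`μ(Cl(F_∞)) = 0 ⟹ H²(𝒪_{F_∞}[1/S], ℤ/p) = 0`» in the proof of
Coates–Sujatha's Thm. 3.4 as re-proved by Kurihara–Pollack (2007, §3.1): unramified `ℤ/p`-extensions of a
number field are controlled by the `p`-rank of its class group.

References: [Washington1997] §13.3 (Lemma 13.15, Prop. 13.22/13.23); [Cox2013] §5.C Cor. 5.24, §8.A Thm. 8.10;
[SerreLocalFields1979] Ch. I §7 Prop. 22 (b); [CoatesSujatha2005] Thm. 3.4; [KuriharaPollack2007] §3.1.
-/

set_option autoImplicit false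

noncomputable section

open scoped Classical Pointwise NumberField
open NumberField IsDedekindDomain Field IntermediateField

namespace Literature.NumberTheory.NumberFields.UnramifiedHomsClassGroupPRankBound

open Literature.NumberTheory.EllipticCurves Literature.NumberTheory.GaloisRepresentations
  Literature.NumberTheory.NumberFields

variable {K : Type} [Field K] [NumberField K]

/-! ## §0 Small group-theoretic and arithmetic helpers -/

/-- A subgroup containing the commutator subgroup is normal. [folklore] -/
private theorem normal_of_commutator_le {G : Type*} [Group G] {N : Subgroup G} (h : ⁅(⊤ : Subgroup G), ⊤⁆ ≤ N) :
    N.Normal :=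
  ⟨fun m hm g => by
    have h2 := Subgroup.commutator_mem_commutator (Subgroup.mem_top g) (Subgroup.mem_top m)
    rw [commutatorElement_def] at h2
    have h1 : g * m * g⁻¹ = g * m * g⁻¹ * m⁻¹ * m := by group
    rw [h1]
    exact mul_mem (h h2) hm⟩

/-- `[Cl : Cl^p]` is invariant under isomorphism of class groups. [folklore] -/
private theorem index_range_pow_eq_of_mulEquiv {G H : Type*} [CommGroup G] [CommGroup H] (e : G ≃* H) (p : ℕ) :
    (powMonoidHom p : H →* H).range.index = (powMonoidHom p : G →* G).range.index := by
  have hmap : (powMonoidHom p : G →* G).range.map e.toMonoidHom = (powMonoidHom p : H →* H).range := by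
    ext h
    constructor
    · rintro ⟨x, ⟨y, rfl⟩, rfl⟩
      exact ⟨e y, by rw [powMonoidHom_apply, powMonoidHom_apply, MulEquiv.coe_toMonoidHom, map_pow]⟩
    · rintro ⟨y, rfl⟩
      refine ⟨e.symm y ^ p, ⟨e.symm y, rfl⟩, ?_⟩
      rw [powMonoidHom_apply, MulEquiv.coe_toMonoidHom, map_pow, MulEquiv.apply_symm_apply]
  rw [← hmap, Subgroup.index_map_of_bijective e.bijective]

/-- An additive map `g` from a group to an abelian group killed by `p` has a kernel SUBGROUP containing the
commutators and the `p`-th powers. [folklore] -/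
private theorem exists_ker_subgroup {G : Type*} [Group G] {M : Type*} [AddCommGroup M]
    (p : ℕ) (hpM : ∀ m : M, p • m = 0) (g : G → M) (hadd : ∀ u v, g (u * v) = g u + g v) :
    ∃ Z : Subgroup G, (∀ x, x ∈ Z ↔ g x = 0) ∧ ⁅(⊤ : Subgroup G), ⊤⁆ ≤ Z ∧
      Subgroup.closure (Set.range fun u : G => u ^ p) ≤ Z := by
  let ĝ : G →* Multiplicative M :=
    { toFun := fun u => Multiplicative.ofAdd (g u)
      map_one' := by
        have h := hadd 1 1
        rw [mul_one, left_eq_add] at h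
        rw [h]; rfl
      map_mul' := fun a b => by rw [hadd, ofAdd_add] }
  refine ⟨ĝ.ker, fun x => ?_, ?_, ?_⟩
  · rw [MonoidHom.mem_ker]
    exact ⟨fun h => Multiplicative.ofAdd.injective h, fun h => by
      change Multiplicative.ofAdd (g x) = 1
      rw [h]; rfl⟩
  · intro y hy
    rw [← commutator_def] at hy
    exact Abelianization.commutator_subset_ker ĝ hy
  · rw [Subgroup.closure_le]
    rintro _ ⟨y, rfl⟩
    rw [SetLike.mem_coe, MonoidHom.mem_ker, map_pow]
    change Multiplicative.ofAdd (g y) ^ p = 1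
    rw [← ofAdd_nsmul, hpM]; rfl

omit [NumberField K] in
/-- A prime of `\bar ℤ_K` above a given maximal ideal of `𝓞 L`, for a number field `L ⊆ K̄`
(integrality of `\bar ℤ_K` over `𝓞 L`); it is maximal. [folklore] -/
private theorem exists_isMaximal_comap_ringOfIntegersToIntegralClosure_eq
    (L : IntermediateField K (AlgebraicClosure K)) (Q : Ideal (𝓞 L)) [hQ : Q.IsMaximal] :
    ∃ 𝔓 : Ideal (absIntegers (𝓞 K) K), 𝔓.IsMaximal ∧
      𝔓.comap (EllipticCurves.ringOfIntegersToIntegralClosure (k := K)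
        (Ω := AlgebraicClosure K) L) = Q := by
  set φ : 𝓞 L →+* absIntegers (𝓞 K) K :=
    EllipticCurves.ringOfIntegersToIntegralClosure (k := K) (Ω := AlgebraicClosure K) L with hφ
  letI : Algebra (𝓞 L) (absIntegers (𝓞 K) K) := φ.toAlgebra
  haveI : IsScalarTower (𝓞 K) (𝓞 L) (absIntegers (𝓞 K) K) :=
    IsScalarTower.of_algebraMap_eq fun x ↦ rfl
  haveI : Algebra.IsIntegral (𝓞 L) (absIntegers (𝓞 K) K) :=
    ⟨fun x ↦ (Algebra.IsIntegral.isIntegral (R := 𝓞 K) x).tower_top⟩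
  obtain ⟨𝔓, -, h𝔓prime, h𝔓Q⟩ := Ideal.exists_ideal_over_prime_of_isIntegral Q
    (⊥ : Ideal (absIntegers (𝓞 K) K))
    (fun x hx ↦ by
      rw [Ideal.mem_comap, Ideal.mem_bot] at hx
      have hx0 : x = 0 :=
        EllipticCurves.ringOfIntegersToIntegralClosure_injective L (hx.trans (map_zero _).symm)
      rw [hx0]
      exact Q.zero_mem)
  haveI := h𝔓prime
  refine ⟨𝔓, Ideal.isMaximal_of_isIntegral_of_isMaximal_comap (R := 𝓞 L) 𝔓 ?_, h𝔓Q⟩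
  rw [h𝔓Q]
  exact hQ

/-! ## §1 The subgroup `U' = W · [U,U] · U^p` -/

section Main

variable (p : ℕ) [Fact p.Prime]
  (U : Subgroup (absoluteGaloisGroup K)) [hUn : U.Normal]
  (W : Subgroup (absoluteGaloisGroup K)) [hWn : W.Normal]

omit [NumberField K] [Fact p.Prime] in
/-- The subgroup of `U` generated (inside `U`) by `W ∩ U`, the commutators and the `p`-th powers, pushed to
`Γ_K`, is normal in `Γ_K`: each generating piece is stable under conjugation by `Γ_K`, which acts on the
normal subgroup `U` through `MulAut.conjNormal`. [folklore] -/
private theorem map_subtype_sup_normal :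
    ((W.subgroupOf U ⊔ ⁅(⊤ : Subgroup U), ⊤⁆ ⊔
      Subgroup.closure (Set.range fun u : U => u ^ p)).map U.subtype).Normal := by
  set S : Subgroup U := W.subgroupOf U ⊔ ⁅(⊤ : Subgroup U), ⊤⁆ ⊔
    Subgroup.closure (Set.range fun u : U => u ^ p) with hS
  -- `S` is stable under `conjNormal γ` for every `γ`
  have hstab : ∀ γ : absoluteGaloisGroup K, S.map (MulAut.conjNormal γ : U ≃* U).toMonoidHom ≤ S := by
    intro γ
    rw [hS, Subgroup.map_sup, Subgroup.map_sup]
    refine sup_le (sup_le ?_ ?_) ?_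
    · -- `W ∩ U`
      rintro _ ⟨x, hx, rfl⟩
      have hxW : (x : absoluteGaloisGroup K) ∈ W := Subgroup.mem_subgroupOf.1 hx
      refine Subgroup.mem_sup_left (Subgroup.mem_sup_left (Subgroup.mem_subgroupOf.2 ?_))
      change (((MulAut.conjNormal γ : U ≃* U) x : U) : absoluteGaloisGroup K) ∈ W
      rw [MulAut.conjNormal_apply]
      exact hWn.conj_mem _ hxW γ
    · -- commutators
      rw [Subgroup.map_commutator]
      exact (Subgroup.commutator_mono le_top le_top).trans (le_sup_right.trans le_sup_left)
    · -- `p`-th powers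
      rw [MonoidHom.map_closure]
      refine (Subgroup.closure_mono ?_).trans le_sup_right
      rintro _ ⟨_, ⟨u, rfl⟩, rfl⟩
      exact ⟨(MulAut.conjNormal γ : U ≃* U) u, (map_pow _ u p).symm⟩
  refine ⟨fun n hn γ => ?_⟩
  obtain ⟨x, hx, rfl⟩ := hn
  have hmem : (MulAut.conjNormal γ : U ≃* U) x ∈ S := hstab γ ⟨x, hx, rfl⟩
  refine ⟨(MulAut.conjNormal γ : U ≃* U) x, hmem, ?_⟩
  rw [Subgroup.coe_subtype, MulAut.conjNormal_apply]

/-! ## §2–§4 The count -/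

/-- **CFT count.** For `K` a number field, `p` an odd prime, `U ≤ Γ_K` open normal with fixed field
`F = K̄^U`, `W ≤ U` open and normal in `Γ_K`, `M` a finite abelian group with `p·M = 0`: a finite set `T` of
maps `g : U → M` that are additive, kill `W` and kill `U ∩ I_𝔓` for every maximal ideal `𝔓` of `\bar ℤ_K`
(everywhere unramified) has **`#T ≤ #M ^ [Cl(F) : Cl(F)^p]`**.  All `g` factor through
`G = Gal(E'/F)` for `E' = K̄^{W·[U,U]·U^p}` (an elementary abelian `p`-extension of `F`, unramified at the
infinite places as `p` is odd) and kill its inertia groups, which are restrictions of the absolute ones; the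
tree's `index_sup_pow_dvd_index_range_pow` (Washington Lemma 13.15 / Prop. 13.23, Cox Cor. 5.24) bounds the
index of the subgroup they all kill by `[Cl(F) : Cl(F)^p]`.
[cite: Washington1997, §13.3 Lemma 13.15 and Prop. 13.23] [cite: Cox2013, §5.C Cor. 5.24]
[cite: SerreLocalFields1979, Ch. I §7 Prop. 22(b)] [cite: KuriharaPollack2007, §3.1 (proof of [CS05] Thm. 3.4)] -/
theorem card_le_pow_index_of_unramified (hp : p ≠ 2)
    (hU : IsOpen (U : Set (absoluteGaloisGroup K)))
    (hW : IsOpen (W : Set (absoluteGaloisGroup K))) (hWU : W ≤ U)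
    (M : Type) [AddCommGroup M] [Finite M] (hpM : ∀ m : M, p • m = 0)
    (T : Finset (U → M))
    (hadd : ∀ g ∈ T, ∀ u v : U, g (u * v) = g u + g v)
    (hW0 : ∀ g ∈ T, ∀ u : U, (u : absoluteGaloisGroup K) ∈ W → g u = 0)
    (hI0 : ∀ g ∈ T, ∀ (𝔓 : Ideal (absIntegers (𝓞 K) K)), 𝔓.IsMaximal →
      ∀ u : U, (u : absoluteGaloisGroup K) ∈ 𝔓.inertia (absoluteGaloisGroup K) → g u = 0) :
    T.card ≤ Nat.card M ^
      (powMonoidHom p : ClassGroup (𝓞 (fixedField U : IntermediateField K (AlgebraicClosure K))) →*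
        ClassGroup (𝓞 (fixedField U : IntermediateField K (AlgebraicClosure K)))).range.index := by
  have hpr : p.Prime := Fact.out
  haveI : Algebra.IsAlgebraic K (AlgebraicClosure K) := AlgebraicClosure.isAlgebraic K
  haveI : IsGalois K (AlgebraicClosure K) := {}
  -- restriction to a normal subfield, applied to an element
  have hres_apply : ∀ (E : IntermediateField K (AlgebraicClosure K)) [Normal K E]
      (σ : absoluteGaloisGroup K) (y : E),
      ((absRestrictNormalHom E σ y : E) : AlgebraicClosure K) = σ • (y : AlgebraicClosure K) :=
    fun E _ σ y => AlgEquiv.restrictNormalHom_apply E _ y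
  -- §1 the subgroup `U'`
  set S : Subgroup U := W.subgroupOf U ⊔ ⁅(⊤ : Subgroup U), ⊤⁆ ⊔
    Subgroup.closure (Set.range fun u : U => u ^ p) with hS
  set U' : Subgroup (absoluteGaloisGroup K) := S.map U.subtype with hU'def
  haveI hU'n : U'.Normal := map_subtype_sup_normal p U W
  have hU'le : U' ≤ U := by
    rintro _ ⟨x, -, rfl⟩
    exact x.2
  have hWU' : W ≤ U' := by
    intro w hw
    exact ⟨⟨w, hWU hw⟩, Subgroup.mem_sup_left (Subgroup.mem_sup_left (Subgroup.mem_subgroupOf.2 hw)), rfl⟩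
  have hU'open : IsOpen (U' : Set (absoluteGaloisGroup K)) := Subgroup.isOpen_mono hWU' hW
  -- every `g ∈ T` kills `U'`
  have hkill : ∀ g ∈ T, ∀ u : U, (u : absoluteGaloisGroup K) ∈ U' → g u = 0 := by
    intro g hg u hu
    obtain ⟨x, hx, hxu⟩ := hu
    have hxu' : x = u := Subtype.ext hxu
    subst hxu'
    obtain ⟨Z, hZ, hZc, hZp⟩ := exists_ker_subgroup p hpM g (hadd g hg)
    have hSZ : S ≤ Z :=
      sup_le (sup_le (fun y hy => (hZ y).2 (hW0 g hg y (Subgroup.mem_subgroupOf.1 hy))) hZc) hZp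
    exact (hZ x).1 (hSZ hx)
  -- §2 the fields `F = K̄^U ≤ E' = K̄^{U'}`
  set F : IntermediateField K (AlgebraicClosure K) := fixedField U with hFdef
  set E' : IntermediateField K (AlgebraicClosure K) := fixedField U' with hE'def
  have hFU : F.fixingSubgroup = U := fixingSubgroup_fixedField_of_isOpen U hU
  have hE'U' : E'.fixingSubgroup = U' := fixingSubgroup_fixedField_of_isOpen U' hU'open
  -- membership dictionaries (the two Galois-group types are definitionally equal)
  have hUiff : ∀ σ : absoluteGaloisGroup K, σ ∈ U ↔ ∀ x ∈ F, σ • x = x := fun σ => by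
    refine (SetLike.ext_iff.mp hFU σ).symm.trans ?_
    exact IntermediateField.mem_fixingSubgroup_iff F (absoluteGaloisGroup.toAlgEquiv K σ)
  have hFE' : F ≤ E' := by
    rw [hE'def, IntermediateField.le_iff_le]
    intro σ hσ
    exact (SetLike.ext_iff.mp hFU σ).2 (hU'le hσ)
  haveI : FiniteDimensional K E' := finiteDimensional_fixedField_of_isOpen U' hU'open
  haveI : FiniteDimensional K F := finiteDimensional_fixedField_of_isOpen U hU
  haveI hE'gal : IsGalois K E' := by
    rw [← InfiniteGalois.normal_iff_isGalois, hE'U']; exact hU'n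
  haveI : NumberField E' := NumberField.of_module_finite K E'
  -- `F` as an intermediate field of `E'/K`
  set F' : IntermediateField K E' := IntermediateField.restrict hFE' with hF'def
  haveI : FiniteDimensional K F' := IntermediateField.finiteDimensional_left F'
  haveI : NumberField F' := NumberField.of_module_finite K F'
  haveI : IsGalois F' E' := IsGalois.tower_top_of_isGalois K F' E'
  haveI : FiniteDimensional F' E' := Module.Finite.of_restrictScalars_finite K F' E'
  -- an element of `Γ_K` whose restriction to `E'` is `F'`-linear lies in `U`
  have hmemU_of : ∀ (σ : absoluteGaloisGroup K) (τ : E' ≃ₐ[F'] E'),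
      absRestrictNormalHom E' σ = τ.restrictScalars K → σ ∈ U := by
    intro σ τ hσ
    rw [hUiff]
    intro x hx
    have hx' : (⟨x, hFE' hx⟩ : E') ∈ F' := (IntermediateField.mem_restrict hFE' _).2 hx
    have h1 := hres_apply E' σ ⟨x, hFE' hx⟩
    rw [hσ, AlgEquiv.restrictScalars_apply] at h1
    rw [← h1]
    exact congrArg (fun z : E' => (z : AlgebraicClosure K)) (τ.commutes ⟨_, hx'⟩)
  -- the restriction `π : U → Gal(E'/F')`
  have hres_mem : ∀ u : U, absRestrictNormalHom E' (u : absoluteGaloisGroup K) ∈ F'.fixingSubgroup := by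
    intro u
    rw [IntermediateField.mem_fixingSubgroup_iff]
    intro x hx
    apply Subtype.ext
    rw [hres_apply]
    exact (hUiff u).1 u.2 _ ((IntermediateField.mem_restrict hFE' x).1 hx)
  let π : U →* (E' ≃ₐ[F'] E') :=
    (IntermediateField.fixingSubgroupEquiv F').toMonoidHom.comp
      (((absRestrictNormalHom E').comp U.subtype).codRestrict F'.fixingSubgroup hres_mem)
  have hπ_restrictScalars : ∀ u : U, (π u).restrictScalars K =
      absRestrictNormalHom E' (u : absoluteGaloisGroup K) := fun u => rfl
  -- `π` is surjective
  have hπ_surj : Function.Surjective π := by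
    intro τ
    obtain ⟨σ, hσ⟩ := absRestrictNormalHom_surjective E' (τ.restrictScalars K)
    refine ⟨⟨σ, hmemU_of σ τ hσ⟩, ?_⟩
    apply AlgEquiv.restrictScalars_injective K
    rw [hπ_restrictScalars]
    exact hσ
  -- `π u = 1` iff `u ∈ U'`
  have hker_π : ∀ u : U, π u = 1 → (u : absoluteGaloisGroup K) ∈ U' := by
    intro u hu
    have h1 : absRestrictNormalHom E' (u : absoluteGaloisGroup K) = 1 := by
      rw [← hπ_restrictScalars, hu]; exact AlgEquiv.ext fun _ => rfl
    rw [absRestrictNormalHom_eq_one_iff] at h1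
    exact (SetLike.ext_iff.mp hE'U' _).1 h1
  have hπ_eq_one : ∀ u : U, (u : absoluteGaloisGroup K) ∈ U' → π u = 1 := by
    intro u hu
    apply AlgEquiv.restrictScalars_injective K
    rw [hπ_restrictScalars]
    have h1 : absRestrictNormalHom E' (u : absoluteGaloisGroup K) = 1 :=
      (absRestrictNormalHom_eq_one_iff E' _).2 ((SetLike.ext_iff.mp hE'U' _).2 hu)
    rw [h1]
    exact AlgEquiv.ext fun _ => rfl
  have hfactor : ∀ g ∈ T, ∀ u₁ u₂ : U, π u₁ = π u₂ → g u₁ = g u₂ := by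
    intro g hg u₁ u₂ h
    have h1 : π (u₂⁻¹ * u₁) = 1 := by rw [map_mul, map_inv, h, inv_mul_cancel]
    have h2 := hkill g hg _ (hker_π _ h1)
    have h3 : g u₁ = g (u₂ * (u₂⁻¹ * u₁)) := by rw [mul_inv_cancel_left]
    rw [h3, hadd g hg, h2, add_zero]
  -- the descended maps `ḡ`
  let desc : (U → M) → ((E' ≃ₐ[F'] E') → M) := fun g τ => g (Function.surjInv hπ_surj τ)
  have hdesc : ∀ g ∈ T, ∀ u : U, desc g (π u) = g u := fun g hg u =>
    hfactor g hg _ _ (Function.surjInv_eq hπ_surj (π u))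
  have hdesc_add : ∀ g ∈ T, ∀ a b, desc g (a * b) = desc g a + desc g b := by
    intro g hg a b
    obtain ⟨x, rfl⟩ := hπ_surj a
    obtain ⟨y, rfl⟩ := hπ_surj b
    rw [← map_mul, hdesc g hg, hdesc g hg, hdesc g hg, hadd g hg]
  have hdesc_inj : Set.InjOn desc T := by
    intro g₁ hg₁ g₂ hg₂ h
    funext u
    rw [← hdesc g₁ hg₁ u, ← hdesc g₂ hg₂ u, h]
  -- `G = Gal(E'/F')` has exponent `p`, hence odd order: `E'/F'` is unramified at the infinite places
  have hexp : ∀ τ : E' ≃ₐ[F'] E', τ ^ p = 1 := by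
    intro τ
    obtain ⟨u, rfl⟩ := hπ_surj τ
    rw [← map_pow]
    exact hπ_eq_one _ ⟨u ^ p, Subgroup.mem_sup_right (Subgroup.subset_closure ⟨u, rfl⟩), rfl⟩
  haveI : IsUnramifiedAtInfinitePlaces F' E' := by
    apply IsUnramifiedAtInfinitePlaces_of_odd_card_aut
    have hG : IsPGroup p (E' ≃ₐ[F'] E') := fun τ => ⟨1, by rw [pow_one]; exact hexp τ⟩
    obtain ⟨k, hk⟩ := hG.exists_card_eq
    rw [hk]
    exact (hpr.odd_of_ne_two hp).pow
  -- §3 every `ḡ` kills the inertia groups of `G`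
  have hinert : ∀ g ∈ T, ∀ (Q : MaximalSpectrum (𝓞 E')),
      ∀ τ ∈ Q.asIdeal.inertia (E' ≃ₐ[F'] E'), desc g τ = 0 := by
    intro g hg Q τ hτ
    haveI := Q.isMaximal
    obtain ⟨𝔓, h𝔓max, h𝔓Q⟩ := exists_isMaximal_comap_ringOfIntegersToIntegralClosure_eq E' Q.asIdeal
    haveI := h𝔓max
    have hτK : τ.restrictScalars K ∈ Q.asIdeal.inertia (E' ≃ₐ[K] E') := by
      rw [AddSubgroup.mem_inertia] at hτ ⊢
      intro x
      rw [RingOfIntegers.restrictScalars_smul]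
      exact hτ x
    rw [← h𝔓Q, inertia_comap_ringOfIntegers_eq_map_absRestrictNormalHom E' 𝔓] at hτK
    obtain ⟨σ, hσI, hσ⟩ := hτK
    have hσU : σ ∈ U := hmemU_of σ τ hσ
    have hπσ : π ⟨σ, hσU⟩ = τ := by
      apply AlgEquiv.restrictScalars_injective K
      rw [hπ_restrictScalars]
      exact hσ
    rw [← hπσ, hdesc g hg]
    exact hI0 g hg 𝔓 h𝔓max ⟨σ, hσU⟩ hσI
  -- §4 the subgroup killed by every `ḡ` and the class-field-theoretic index bound
  set Ngrp : Subgroup (E' ≃ₐ[F'] E') :=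
    ⁅(⊤ : Subgroup (E' ≃ₐ[F'] E')), ⊤⁆ ⊔ ⨆ (Q : MaximalSpectrum (𝓞 E')), Q.asIdeal.inertia (E' ≃ₐ[F'] E')
    with hNgrp
  set N₂ : Subgroup (E' ≃ₐ[F'] E') :=
    Ngrp ⊔ Subgroup.closure (Set.range fun σ : E' ≃ₐ[F'] E' => σ ^ p) with hN₂
  have hcomm : ⁅(⊤ : Subgroup (E' ≃ₐ[F'] E')), ⊤⁆ ≤ Ngrp := le_sup_left
  have hIN : ∀ (Q : Ideal (𝓞 E')) [Q.IsMaximal], Q.inertia (E' ≃ₐ[F'] E') ≤ Ngrp := by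
    intro Q hQ
    exact le_trans (le_iSup (fun Q : MaximalSpectrum (𝓞 E') => Q.asIdeal.inertia (E' ≃ₐ[F'] E')) ⟨Q, hQ⟩)
      le_sup_right
  have hdvd := index_sup_pow_dvd_index_range_pow F' E' Ngrp hcomm hIN p
  haveI hN₂n : N₂.Normal := normal_of_commutator_le (hcomm.trans le_sup_left)
  -- every `ḡ` kills `N₂`
  have hkillN : ∀ g ∈ T, ∀ τ ∈ N₂, desc g τ = 0 := by
    intro g hg τ hτ
    obtain ⟨Z, hZ, hZc, hZp⟩ := exists_ker_subgroup p hpM (desc g) (hdesc_add g hg)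
    have hNZ : N₂ ≤ Z := by
      refine sup_le (sup_le hZc (iSup_le fun Q => fun x hx => (hZ x).2 (hinert g hg Q x hx))) hZp
    exact (hZ τ).1 (hNZ hτ)
  -- the `ḡ` are distinct functions on `G/N₂`
  let lift : (U → M) → ((E' ≃ₐ[F'] E') ⧸ N₂ → M) := fun g q => desc g q.out
  have hlift : ∀ g ∈ T, ∀ τ, lift g (QuotientGroup.mk τ) = desc g τ := by
    intro g hg τ
    change desc g (QuotientGroup.mk τ : (E' ≃ₐ[F'] E') ⧸ N₂).out = desc g τ
    have h1 : ((QuotientGroup.mk τ : (E' ≃ₐ[F'] E') ⧸ N₂).out)⁻¹ * τ ∈ N₂ := by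
      rw [← QuotientGroup.eq, QuotientGroup.out_eq']
    have h2 : τ = (QuotientGroup.mk τ : (E' ≃ₐ[F'] E') ⧸ N₂).out *
        (((QuotientGroup.mk τ : (E' ≃ₐ[F'] E') ⧸ N₂).out)⁻¹ * τ) := by rw [mul_inv_cancel_left]
    conv_rhs => rw [h2]
    rw [hdesc_add g hg, hkillN g hg _ h1, add_zero]
  have hlift_inj : Set.InjOn lift T := by
    intro g₁ hg₁ g₂ hg₂ h
    apply hdesc_inj hg₁ hg₂
    funext τ
    rw [← hlift g₁ hg₁, ← hlift g₂ hg₂, h]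
  -- counting
  have h1 : T.card ≤ Nat.card M ^ N₂.index := by
    have hinj : Function.Injective (fun g : (T : Set (U → M)) => lift g.1) := fun a b h =>
      Subtype.ext (hlift_inj a.2 b.2 h)
    have hle := Nat.card_le_card_of_injective _ hinj
    have hidx : Nat.card ((E' ≃ₐ[F'] E') ⧸ N₂) = N₂.index := rfl
    rw [Nat.card_coe_set_eq, Set.ncard_coe_finset, Nat.card_fun, hidx] at hle
    exact hle
  -- `[G : N₂] ≤ [Cl(F') : Cl(F')^p] = [Cl(F) : Cl(F)^p]`
  have hMpos : 0 < Nat.card M := Nat.card_pos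
  have hidx_pos : 0 < (powMonoidHom p : ClassGroup (𝓞 F') →* ClassGroup (𝓞 F')).range.index :=
    Nat.pos_of_ne_zero Subgroup.index_ne_zero_of_finite
  have h2 : N₂.index ≤ (powMonoidHom p : ClassGroup (𝓞 F') →* ClassGroup (𝓞 F')).range.index :=
    Nat.le_of_dvd hidx_pos hdvd
  have eCl : ClassGroup (𝓞 F) ≃* ClassGroup (𝓞 F') :=
    ClassGroup.mulEquiv (RingOfIntegers.mapRingEquiv (IntermediateField.restrict_algEquiv hFE').toRingEquiv)
  have h3 : (powMonoidHom p : ClassGroup (𝓞 F') →* ClassGroup (𝓞 F')).range.index =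
      (powMonoidHom p : ClassGroup (𝓞 F) →* ClassGroup (𝓞 F)).range.index :=
    index_range_pow_eq_of_mulEquiv eCl p
  calc T.card ≤ Nat.card M ^ N₂.index := h1
    _ ≤ Nat.card M ^ (powMonoidHom p : ClassGroup (𝓞 F') →* ClassGroup (𝓞 F')).range.index :=
        Nat.pow_le_pow_right hMpos h2
    _ = _ := by rw [h3]

end Main

end Literature.NumberTheory.NumberFields.UnramifiedHomsClassGroupPRankBound

end
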